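import Summits.BirchSwinnertonDyer.BirchSwinnertonDyer.Theorems.ThetaPartnerAtTwoSignedControlAtTwoCoatesGreenbergUnconditional
import Summits.BirchSwinnertonDyer.BirchSwinnertonDyer.Theorems.ResidualThetaTransportAtTwoThetaTransportResidualKummerAtTwo
import Literature.NumberTheory.EllipticCurves.IwasawaSelmerSupersingularLocalProofs
import Literature.NumberTheory.EllipticCurves.IwasawaSelmer
import Literature.NumberTheory.EllipticCurves.Sprung2012.ColemanMaps
import Literature.NumberTheory.EllipticCurves.SubgroupSelmerCocycleCriteriaProofs
import Literature.NumberTheory.EllipticCurves.PeriodIndexCorestrictionLocal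
import Literature.NumberTheory.EllipticCurves.SelmerCorankControlRatProofs
import Literature.NumberTheory.EllipticCurves.Rank1Residual.Predicates
import Literature.NumberTheory.EllipticCurves.GreenbergVatsal2000.GreenbergSelmerGroups
import Literature.NumberTheory.EllipticCurves.GreenbergSelmer
import HarnessLib

/-!
# «Kummer = everything at `v ∣ 2` over `ℚ_∞`» on the `ρ`-side: the RELAXED Θ-Kummer clause of SelRel₍C4₎ holds for EVERY class, so
# `SelRel = {unramified outside 2S₀ ∧ trivial at ∞}` as SETS, and a transferred class needs only T1 ∧ T2 to be a test class

Route `ResidualThetaTransportAtTwo` (RTT), crux RSL_g `ResidualSignedLambdaLowerCMAtTwo` (stmt-BirchSwinnertonDyer-22608), line «onepair», split items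
5–8 (test space `↥SelRel`); seat `prover-bsd-wall-tp2-p2x-w2` g19 (`--supports`, closes nothing). THEOREMS ONLY (no definition, no named fact, no
instance, no `sorry`). STUB-PLAN rev 21.1 **S87** adoption list (critic g21; credit: stub-ideation card k1-g14): `mem_selRel_of_unr_inf` (S4₂'s (M),
the zero-transport road; the tower-transport road is `…CofreeSelmerTransferRelaxed`), `selRel_eq_unrInf` (lets the LEAD type SelRel either way, Q88),
`relaxedKummerClause_conjH1` (∀σ from σ = 1 for any `Γ_v`-stable target), `kummerClause_mono`. PRICE recorded by the critic (T55): this does NOT give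
the VALUE `c₂ z (loc₂ (τ b))` — that is read off the EXACT transported datum (`…CofreeSelmerTransferRelaxed` §1/§4) — and never the PLUS clause.
BSD is not proved by any of this; RSL_g (22608) and (R≥)ᵖ (26074) stay OPEN.

-- adapted from `Cruxes/ResidualThetaCountLowerPureAtTwo/Sketch_sidea_k1_g14.lean` §0–§4 (stub-ideation k1 g14, kernel-checked there and by the
-- critic, V89): the namespace is moved under `Theorems.ThetaTransport.CofreeSelmerTransfer`; statements and proofs unchanged.

* §0 `discreteH1_localPoints_eq_zero_of_pow_nsmul_eq_zero[']` — W-side: `H¹(Gal(K̄_v/K_∞K_v), E(K̄_v))[p^∞] = 0` at a good supersingular `v ∣ p` of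
  the cyclotomic tower (Greenberg LNM 1716 pp. 83–84 with Coates–Greenberg Cor. 3.2 = the TREE theorem `CoatesGreenberg1996_H1_formalGroup_trivial_holds`,
  `…CoatesGreenbergUnconditional`; unconditional).
* §1 **`exists_towerKummer_of_cocycle`** — T3♭, cocycle form: on the habitat `GoodSS W 2`, for ANY discrete `Γ_ℚ`-module `A`, ANY additive
  `Ψ : A →+ (W[2^∞])ⁿ` commuting coordinatewise with `D_v`, EVERY continuous cocycle `Γ_∞ → A` is, read through `Ψ` at `v ∋ 2`, the Kummer cocycle of
  some `Q : Fin n → E(K̄_v)` with `2ᵏ Q_i ∈ E(ℚ_∞·ℚ_v)` (tower points), `k` uniform.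
* §2 **`relaxedKummerClause_conjH1`** (class form = VERBATIM the third clause of SelRel₍C4₎, every class, every `σ`), `exists_kummerData` (σ-free).
* §3 `setOf_relaxedKummer_eq`, **`selRel_eq_unrInf`**, **`mem_selRel_of_unr_inf`**, `kummerClause_mono`.
* §4 `localKerOver_kerSubgroup_eq_top_at_two` (the W-side twin on the habitat, by name).

References: [GreenbergLNM1716] §2 pp. 83–84; [CoatesGreenberg1996] Cor. 3.2; [GreenbergVatsal2000] §2 pp. 16, 23; [Kobayashi2003] Def. 1.1;
[Sprung2012] §1 p. 1486, Lemma 7.10; [SerreGaloisCohomology1997] I §2.2, §5.1.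
-/

set_option autoImplicit false
-- the Theorems namespace of this sub repeats the summit name by design (D-0017 nested layout)
set_option linter.dupNamespace false

noncomputable section

open scoped AddSubgroup
open WeierstrassCurve NumberField Field IsDedekindDomain Literature Literature.NumberTheory.EllipticCurves
  Literature.NumberTheory.GaloisRepresentations

namespace Summit.BirchSwinnertonDyer.BirchSwinnertonDyer.Theorems.ThetaTransport.CofreeSelmerTransfer

/-! ## §0  W-side: no `p`-power torsion in `H¹(H_v, E(K̄_v))` (unconditional Coates–Greenberg) -/

/-- **`H¹(K_∞K_v, E)(p) = 0` at a good supersingular `v ∣ p` of the cyclotomic `ℤ_p`-tower**, in the form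
"a class killed by `pᵏ` is zero"; steps (1)(2) of `localKerOver_kerSubgroup_eq_top_of_supersingular` with its
Coates–Greenberg hypothesis DISCHARGED by the tree theorem `CoatesGreenberg1996_H1_formalGroup_trivial_holds`.
[cite: GreenbergLNM1716, §2 pp. 83–84] [cite: CoatesGreenberg1996, Cor. 3.2] -/
theorem discreteH1_localPoints_eq_zero_of_pow_nsmul_eq_zero {K : Type} [Field K] [NumberField K]
    (W : WeierstrassCurve K) [W.IsElliptic] {p : ℕ} [Fact p.Prime] (κ : ZpExtension K p) (hκ : κ.IsCyclotomic)
    {v : HeightOneSpectrum (𝓞 K)} (hpv : (p : 𝓞 K) ∈ v.asIdeal) (hgood : W.HasGoodReductionAt v)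
    (hss : ¬ W.HasUnitRootAt v) (k : ℕ)
    (z : discreteH1 (localSubgroup κ.kerSubgroup (v.adicCompletion K)) (localPoints W (v.adicCompletion K)))
    (hz : p ^ k • z = 0) : z = 0 := by
  have h1 : ∀ z : discreteH1 (localSubgroup κ.kerSubgroup (v.adicCompletion K))
      (localPoints W (v.adicCompletion K)), p • z = 0 → z = 0 :=
    Literature.NumberTheory.EllipticCurves.eq_zero_of_nsmul_eq_zero_of_forall_cocycle
      (W.localKernelOfReduction v)
      (fun m ↦ by
        have hc : Continuous ((fun σ : absoluteGaloisGroup (v.adicCompletion K) ↦ σ • m) ∘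
            (Subtype.val : ↥(localSubgroup κ.kerSubgroup (v.adicCompletion K)) →
              absoluteGaloisGroup (v.adicCompletion K))) :=
          (continuous_smul_localPoints W (v.adicCompletion K) m).comp continuous_subtype_val
        exact hc)
      (W.nsmul_surjective_localPoints (v.adicCompletion K) (Nat.Prime.ne_zero Fact.out))
      (fun m hm ↦ W.mem_localKernelOfReduction_of_prime_nsmul_mem hpv hgood hss hm)
      (Summit.BirchSwinnertonDyer.BirchSwinnertonDyer.Theorems.CoatesGreenberg1996_H1_formalGroup_trivial_holds
        K W p κ v hκ hpv hgood)
  induction k generalizing z with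
  | zero => rwa [pow_zero, one_smul] at hz
  | succ k ih => rw [pow_succ, ← smul_smul] at hz; exact h1 z (ih _ hz)

/-- §0 in the currency of an explicit embedding: the same statement for `localSubgroupOfEmb (ker κ) (closureEmb K_v)`
(definitionally `localSubgroup (ker κ) K_v`), which is the group the route's clauses are typed over. [folklore] -/
theorem discreteH1_localPoints_eq_zero_of_pow_nsmul_eq_zero' {K : Type} [Field K] [NumberField K]
    (W : WeierstrassCurve K) [W.IsElliptic] {p : ℕ} [Fact p.Prime] (κ : ZpExtension K p) (hκ : κ.IsCyclotomic)
    {v : HeightOneSpectrum (𝓞 K)} (hpv : (p : 𝓞 K) ∈ v.asIdeal) (hgood : W.HasGoodReductionAt v)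
    (hss : ¬ W.HasUnitRootAt v) (k : ℕ)
    (z : discreteH1 (localSubgroupOfEmb κ.kerSubgroup (closureEmb (K := K) (v.adicCompletion K)))
      (localPoints W (v.adicCompletion K)))
    (hz : p ^ k • z = 0) : z = 0 :=
  discreteH1_localPoints_eq_zero_of_pow_nsmul_eq_zero W κ hκ hpv hgood hss k z hz

/-! ## §1  ρ-side, cocycle level: the transported Kummer condition at `2` holds for EVERY cocycle -/

variable (W : WeierstrassCurve ℚ) [W.IsElliptic] [W.IsGloballyMinimal]

omit [W.IsElliptic] [W.IsGloballyMinimal] in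
/-- Finitely many values, pushed into `(W[2^∞])ⁿ` by any map, die under a common power of `2`. [folklore] -/
theorem exists_pow_nsmul_apply_eq_zero_of_finite {A : Type} {n : ℕ} (Ψ : A → (Fin n → ↥(W.geomPrimaryTorsion 2)))
    {T : Type} (a : T → A) (hfin : (Set.range a).Finite) : ∃ m : ℕ, ∀ t i, (2 ^ m) • Ψ (a t) i = 0 := by
  obtain ⟨m, hm⟩ := Summit.BirchSwinnertonDyer.BirchSwinnertonDyer.Theorems.ThetaTransport.exists_pow_nsmul_eq_zero W
    (ι := ↥hfin.toFinset × Fin n) fun q ↦ Ψ q.1.1 q.2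
  exact ⟨m, fun t i ↦ hm (⟨a t, hfin.mem_toFinset.2 ⟨t, rfl⟩⟩, i)⟩

/-- **T3♭ (cocycle form, strongest provable version).** On the habitat (`GoodSS W 2`: good supersingular at
`2`), for the cyclotomic `ℤ₂`-extension `κ`, the place `v ∋ 2`, ANY discrete `Γ_ℚ`-module `A`, ANY additive
`Ψ : A →+ (W[2^∞])ⁿ` commuting coordinatewise with the decomposition group at `v`, and EVERY continuous cocycle
`φ : Gal(ℚ̄/ℚ_∞) → A`: the local cocycles `τ ↦ Ψ(φ(τ))_i ∈ E(K̄_v)` (`τ ∈ Gal(K̄_v/ℚ_∞ℚ_v)`) are SIMULTANEOUSLY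
Kummer: `= τ Q_i − Q_i` with `2ᵏ Q_i ∈ E(ℚ_∞·ℚ_v)` (Sprung's tower points). No Serre, no hypothesis on `A`/`ρ`,
no Selmer condition: compactness of `Gal(ℚ̄/ℚ_∞)` + §0.
[cite: GreenbergLNM1716, §2 pp. 83–84 ("Im κ = H¹(K, E[p^∞])")] [cite: CoatesGreenberg1996, Cor. 3.2] -/
theorem exists_towerKummer_of_cocycle (hGood : Rank1Residual.GoodSS W 2)
    (κ : ZpExtension ℚ 2) (hκ : κ.IsCyclotomic)
    (v : HeightOneSpectrum (𝓞 ℚ)) (hv : ((2 : ℕ) : 𝓞 ℚ) ∈ v.asIdeal)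
    {A : Type} [AddCommGroup A] [DistribMulAction (absoluteGaloisGroup ℚ) A] [TopologicalSpace A]
    [DiscreteTopology A] {n : ℕ} (Ψ : A →+ (Fin n → ↥(W.geomPrimaryTorsion 2)))
    (hΨ : ∀ (δ : absoluteGaloisGroup (v.adicCompletion ℚ)) (m : A) (i : Fin n),
      Ψ (resGalOfEmb (closureEmb (K := ℚ) (v.adicCompletion ℚ)) δ • m) i =
        resGalOfEmb (closureEmb (K := ℚ) (v.adicCompletion ℚ)) δ • Ψ m i)
    (φ : contOneCocycles (discreteTopRep ↥κ.kerSubgroup A)) :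
    ∃ (Q : Fin n → localPoints W (v.adicCompletion ℚ)) (k : ℕ),
      (∀ i, (2 ^ k) • Q i ∈ Sprung2012.localTowerPointsOfEmb κ (closureEmb (K := ℚ) (v.adicCompletion ℚ)) W) ∧
      ∀ (τ : localSubgroupOfEmb κ.kerSubgroup (closureEmb (K := ℚ) (v.adicCompletion ℚ))) (i : Fin n),
        pointsMapOfEmb W (closureEmb (K := ℚ) (v.adicCompletion ℚ))
          ((Ψ (φ.1 (resGalSubgroupOfEmb κ.kerSubgroup (closureEmb (K := ℚ) (v.adicCompletion ℚ)) τ)) i :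
            ↥(W.geomPrimaryTorsion 2)) : W.geomPoints) = (τ : absoluteGaloisGroup (v.adicCompletion ℚ)) • Q i - Q i := by
  -- habitat at `v ∋ 2`
  have hgood : W.HasGoodReductionAt v := W.hasGoodReductionAt_of_hasGoodReductionAtPrime v hv hGood.1
  have hss : ¬ W.HasUnitRootAt v := by
    rw [W.hasUnitRootAt_iff_not_dvd_frobeniusTrace v Nat.prime_two hv, not_not]; exact hGood.2
  -- a uniform exponent: `φ` has finite range (`Gal(ℚ̄/ℚ_∞)` compact, `A` discrete)
  haveI : CompactSpace ↥κ.kerSubgroup := isCompact_iff_compactSpace.mp κ.isClosed_kerSubgroup.isCompact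
  have hfin : (Set.range fun τ : localSubgroupOfEmb κ.kerSubgroup (closureEmb (K := ℚ) (v.adicCompletion ℚ)) ↦
      (φ.1 (resGalSubgroupOfEmb κ.kerSubgroup (closureEmb (K := ℚ) (v.adicCompletion ℚ)) τ) : A)).Finite :=
    (isCompact_range φ.1.continuous).finite_of_discrete.subset (by rintro _ ⟨τ, rfl⟩; exact ⟨_, rfl⟩)
  obtain ⟨m, hm⟩ := exists_pow_nsmul_apply_eq_zero_of_finite W Ψ _ hfin
  -- the coordinate maps `A →+ E(K̄_v)`, `a ↦ ι(Ψ(a)_i)`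
  let G : ↥(W.geomPrimaryTorsion 2) →+ localPoints W (v.adicCompletion ℚ) :=
    (pointsMapOfEmb W (closureEmb (K := ℚ) (v.adicCompletion ℚ))).comp (W.geomPrimaryTorsion 2).subtype
  let F : Fin n → (A →+ localPoints W (v.adicCompletion ℚ)) := fun i ↦
    G.comp ((Pi.evalAddMonoidHom (fun _ : Fin n ↦ ↥(W.geomPrimaryTorsion 2)) i).comp Ψ)
  have hF : ∀ (i : Fin n) (x : localSubgroupOfEmb κ.kerSubgroup (closureEmb (K := ℚ) (v.adicCompletion ℚ))) (a : A),
      F i (resGalSubgroupOfEmb κ.kerSubgroup (closureEmb (K := ℚ) (v.adicCompletion ℚ)) x • a) = x • F i a := by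
    intro i x a
    simp only [F, G, AddMonoidHom.coe_comp, AddSubgroup.coe_subtype, Function.comp_apply, Pi.evalAddMonoidHom_apply,
      Subgroup.smul_def, resGalSubgroupOfEmb_apply_coe, hΨ, primaryComponent.coe_smul]
    exact pointsMapOfEmb_smul W _ _ _
  -- the `i`-th transported local cocycle is `2ᵐ`-torsion, hence its class vanishes by §0
  let P : Fin n → contOneCocycles (discreteTopRep
      ↥(localSubgroupOfEmb κ.kerSubgroup (closureEmb (K := ℚ) (v.adicCompletion ℚ))) (localPoints W (v.adicCompletion ℚ))) :=
    fun i ↦ contOneCocycles.pullback (resGalSubgroupOfEmb κ.kerSubgroup (closureEmb (K := ℚ) (v.adicCompletion ℚ)))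
      (resHomOfEquivariant (resGalSubgroupOfEmb κ.kerSubgroup (closureEmb (K := ℚ) (v.adicCompletion ℚ))) (F i) (hF i)) φ
  have hP : ∀ i, (2 ^ m) • P i = 0 := by
    intro i
    refine Subtype.ext (ContinuousMap.ext fun τ ↦ ?_)
    change (2 ^ m) • G (Ψ (φ.1 (resGalSubgroupOfEmb κ.kerSubgroup (closureEmb (K := ℚ) (v.adicCompletion ℚ)) τ)) i) =
      (0 : localPoints W (v.adicCompletion ℚ))
    rw [← map_nsmul, hm τ i, map_zero]
  have h2m : ∀ i, (2 ^ m) • oneCocycleClass _ (P i) = 0 := by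
    intro i
    have e := map_nsmul (oneCocycleClassₗ (discreteTopRep
      ↥(localSubgroupOfEmb κ.kerSubgroup (closureEmb (K := ℚ) (v.adicCompletion ℚ))) (localPoints W (v.adicCompletion ℚ))))
      (2 ^ m) (P i)
    rw [hP i, map_zero] at e
    exact e.symm
  have hzero : ∀ i, resH1Hom (resGalSubgroupOfEmb κ.kerSubgroup (closureEmb (K := ℚ) (v.adicCompletion ℚ))) (F i) (hF i)
      (oneCocycleClass _ φ) = 0 := by
    intro i
    rw [resH1Hom_oneCocycleClass]
    exact discreteH1_localPoints_eq_zero_of_pow_nsmul_eq_zero' W κ hκ hv hgood hss m _ (h2m i)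
  -- read off the Kummer representatives
  have hQ : ∀ i, ∃ Q : localPoints W (v.adicCompletion ℚ),
      ∀ τ : localSubgroupOfEmb κ.kerSubgroup (closureEmb (K := ℚ) (v.adicCompletion ℚ)),
        F i (φ.1 (resGalSubgroupOfEmb κ.kerSubgroup (closureEmb (K := ℚ) (v.adicCompletion ℚ)) τ)) = τ • Q - Q :=
    fun i ↦ (CocycleCriteria.resH1Hom_oneCocycleClass_eq_zero_iff _ _ (hF i) φ).1 (hzero i)
  choose Q hQ using hQ
  refine ⟨Q, m, fun i ↦ ?_, fun τ i ↦ hQ i τ⟩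
  rw [Sprung2012.mem_localTowerPointsOfEmb_iff]
  intro τ hτ
  have h2 : (2 ^ m) • F i (φ.1 (resGalSubgroupOfEmb κ.kerSubgroup (closureEmb (K := ℚ) (v.adicCompletion ℚ)) ⟨τ, hτ⟩)) = 0 := by
    change (2 ^ m) • G (Ψ _ i) = 0
    rw [← map_nsmul, hm, map_zero]
  rw [hQ i ⟨τ, hτ⟩, smul_sub, sub_eq_zero, Subgroup.smul_def, smul_comm] at h2
  exact h2

/-! ## §2  Class form — the third clause of RSL_g / of (C4) `SelRel`, for EVERY class -/

/-- **T3♭ (class form): the relaxed Kummer clause at `2` holds for every class.** For `Θ_v : A ≃+ (W[2^∞])ⁿ`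
commuting with `D_v` (the route's transport datum, any `A`), every `y ∈ H¹(Gal(ℚ̄/ℚ_∞), A)`, every `σ ∈ Γ_ℚ`:
`conj_σ y` restricted to `v ∋ 2` and read through `Θ_v` is the Kummer class of some `Q : Fin n → E(K̄_v)` with
`2ᵏ Q ∈ E(ℚ_∞·ℚ_v)ⁿ` — literally the third clause of (C4)'s `SelRel` (RSL_g's clause with `⨆_m E⁺_m` replaced
by the tower points), so that clause is automatic. [cite: GreenbergLNM1716, §2 pp. 83–84] [cite: CoatesGreenberg1996, Cor. 3.2] -/
theorem relaxedKummerClause_conjH1 (hGood : Rank1Residual.GoodSS W 2) (κ : ZpExtension ℚ 2) (hκ : κ.IsCyclotomic)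
    {A : Type} [AddCommGroup A] [DistribMulAction (absoluteGaloisGroup ℚ) A] [TopologicalSpace A]
    [DiscreteTopology A] {n : ℕ}
    (Θ : ∀ v : HeightOneSpectrum (𝓞 ℚ), ((2 : ℕ) : 𝓞 ℚ) ∈ v.asIdeal → (A ≃+ (Fin n → ↥(W.geomPrimaryTorsion 2))))
    (hΘ : ∀ v hv (δ : absoluteGaloisGroup (v.adicCompletion ℚ)) m i,
      Θ v hv (resGalOfEmb (closureEmb (K := ℚ) (v.adicCompletion ℚ)) δ • m) i =
        resGalOfEmb (closureEmb (K := ℚ) (v.adicCompletion ℚ)) δ • Θ v hv m i)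
    (y : subgroupH1 κ.kerSubgroup A) (v : HeightOneSpectrum (𝓞 ℚ)) (hv : ((2 : ℕ) : 𝓞 ℚ) ∈ v.asIdeal)
    (σ : absoluteGaloisGroup ℚ) :
    ∃ (φ : contOneCocycles (discreteTopRep ↥κ.kerSubgroup A)) (Q : Fin n → localPoints W (v.adicCompletion ℚ)) (k : ℕ),
      oneCocycleClass (discreteTopRep ↥κ.kerSubgroup A) φ = conjH1 κ.kerSubgroup A σ y ∧
      (∀ i, (2 ^ k) • Q i ∈ Sprung2012.localTowerPointsOfEmb κ (closureEmb (K := ℚ) (v.adicCompletion ℚ)) W) ∧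
      ∀ τ i, pointsMapOfEmb W (closureEmb (K := ℚ) (v.adicCompletion ℚ))
        (((Θ v hv (φ.1 (resGalSubgroupOfEmb κ.kerSubgroup (closureEmb (K := ℚ) (v.adicCompletion ℚ)) τ))) i :
          ↥(W.geomPrimaryTorsion 2)) : W.geomPoints) = (τ : absoluteGaloisGroup (v.adicCompletion ℚ)) • Q i - Q i := by
  obtain ⟨φ, hφ⟩ := oneCocycleClass_surjective (discreteTopRep ↥κ.kerSubgroup A) (conjH1 κ.kerSubgroup A σ y)
  obtain ⟨Q, k, hQ, hid⟩ :=
    exists_towerKummer_of_cocycle W hGood κ hκ v hv (Θ v hv).toAddMonoidHom (fun δ m i ↦ hΘ v hv δ m i) φ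
  exact ⟨φ, Q, k, hφ, hQ, fun τ i ↦ hid τ i⟩

/-- **Kummer data exist for EVERY class (σ-free form of §2).** Every `y ∈ H¹(Gal(ℚ̄/ℚ_∞), A)` has, at `v ∋ 2`, a
representative cocycle `φ` and a tuple `Q : Fin n → E(K̄_v)` with `2ᵏ Q ∈ E(ℚ_∞·ℚ_v)ⁿ` satisfying the Θ-Kummer formula —
the EXISTENCE half of the data on which (C3)'s value pins `pair₂` / `c₂` / `loc₂` are written, now on ALL of `H¹`, not only
on `Sg` (uniqueness of the value = the landed `levelValue_eq_of_kummerData`). [cite: CoatesGreenberg1996, Cor. 3.2]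
[cite: GreenbergLNM1716, §2 pp. 83–84] -/
theorem exists_kummerData (hGood : Rank1Residual.GoodSS W 2) (κ : ZpExtension ℚ 2) (hκ : κ.IsCyclotomic)
    {A : Type} [AddCommGroup A] [DistribMulAction (absoluteGaloisGroup ℚ) A] [TopologicalSpace A]
    [DiscreteTopology A] {n : ℕ}
    (Θ : ∀ v : HeightOneSpectrum (𝓞 ℚ), ((2 : ℕ) : 𝓞 ℚ) ∈ v.asIdeal → (A ≃+ (Fin n → ↥(W.geomPrimaryTorsion 2))))
    (hΘ : ∀ v hv (δ : absoluteGaloisGroup (v.adicCompletion ℚ)) m i,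
      Θ v hv (resGalOfEmb (closureEmb (K := ℚ) (v.adicCompletion ℚ)) δ • m) i =
        resGalOfEmb (closureEmb (K := ℚ) (v.adicCompletion ℚ)) δ • Θ v hv m i)
    (y : subgroupH1 κ.kerSubgroup A) (v : HeightOneSpectrum (𝓞 ℚ)) (hv : ((2 : ℕ) : 𝓞 ℚ) ∈ v.asIdeal) :
    ∃ (φ : contOneCocycles (discreteTopRep ↥κ.kerSubgroup A)) (Q : Fin n → localPoints W (v.adicCompletion ℚ)) (k : ℕ),
      oneCocycleClass (discreteTopRep ↥κ.kerSubgroup A) φ = y ∧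
      (∀ i, (2 ^ k) • Q i ∈ Sprung2012.localTowerPointsOfEmb κ (closureEmb (K := ℚ) (v.adicCompletion ℚ)) W) ∧
      ∀ τ i, pointsMapOfEmb W (closureEmb (K := ℚ) (v.adicCompletion ℚ))
        (((Θ v hv (φ.1 (resGalSubgroupOfEmb κ.kerSubgroup (closureEmb (K := ℚ) (v.adicCompletion ℚ)) τ))) i :
          ↥(W.geomPrimaryTorsion 2)) : W.geomPoints) = (τ : absoluteGaloisGroup (v.adicCompletion ℚ)) • Q i - Q i := by
  obtain ⟨φ, Q, k, hφ, hQ, hid⟩ := relaxedKummerClause_conjH1 W hGood κ hκ Θ hΘ y v hv 1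
  refine ⟨φ, Q, k, ?_, hQ, hid⟩
  rw [hφ, conjH1_one_holds κ.kerSubgroup A, AddMonoidHom.id_apply]

/-! ## §3  Weakest sufficient cut: the relaxed Kummer clause of (C4) is redundant -/

/-- **(C4)'s `SelRel` needs no Kummer clause**: for any side conditions `P`, `R` on classes,
`{y | P y ∧ R y ∧ (relaxed Θ-Kummer clause at every v ∋ 2, every σ)} = {y | P y ∧ R y}`. [folklore from §2] -/
theorem setOf_relaxedKummer_eq (hGood : Rank1Residual.GoodSS W 2) (κ : ZpExtension ℚ 2) (hκ : κ.IsCyclotomic)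
    {A : Type} [AddCommGroup A] [DistribMulAction (absoluteGaloisGroup ℚ) A] [TopologicalSpace A]
    [DiscreteTopology A] {n : ℕ}
    (Θ : ∀ v : HeightOneSpectrum (𝓞 ℚ), ((2 : ℕ) : 𝓞 ℚ) ∈ v.asIdeal → (A ≃+ (Fin n → ↥(W.geomPrimaryTorsion 2))))
    (hΘ : ∀ v hv (δ : absoluteGaloisGroup (v.adicCompletion ℚ)) m i,
      Θ v hv (resGalOfEmb (closureEmb (K := ℚ) (v.adicCompletion ℚ)) δ • m) i =
        resGalOfEmb (closureEmb (K := ℚ) (v.adicCompletion ℚ)) δ • Θ v hv m i)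
    (P R : subgroupH1 κ.kerSubgroup A → Prop) :
    {y : subgroupH1 κ.kerSubgroup A | P y ∧ R y ∧ ∀ v hv σ, ∃ (φ : contOneCocycles (discreteTopRep ↥κ.kerSubgroup A))
        (Q : Fin n → localPoints W (v.adicCompletion ℚ)) (k : ℕ),
        oneCocycleClass (discreteTopRep ↥κ.kerSubgroup A) φ = conjH1 κ.kerSubgroup A σ y ∧
        (∀ i, (2 ^ k) • Q i ∈ Sprung2012.localTowerPointsOfEmb κ (closureEmb (K := ℚ) (v.adicCompletion ℚ)) W) ∧
        ∀ τ i, pointsMapOfEmb W (closureEmb (K := ℚ) (v.adicCompletion ℚ))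
          (((Θ v hv (φ.1 (resGalSubgroupOfEmb κ.kerSubgroup (closureEmb (K := ℚ) (v.adicCompletion ℚ)) τ))) i :
            ↥(W.geomPrimaryTorsion 2)) : W.geomPoints) = (τ : absoluteGaloisGroup (v.adicCompletion ℚ)) • Q i - Q i}
      = {y | P y ∧ R y} :=
  Set.ext fun y ↦ ⟨fun h ↦ ⟨h.1, h.2.1⟩, fun h ↦ ⟨h.1, h.2, fun v hv σ ↦
    relaxedKummerClause_conjH1 W hGood κ hκ Θ hΘ y v hv σ⟩⟩

/-- **`SelRel = S-relaxed Selmer cut`** in the vocabulary of RSL_g's first two clauses: unramified outside `2S₀`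
and trivial at `∞` (all conjugates) — the relaxed Kummer clause at `2` adds nothing (k3-g7 PLAN 1 = PLAN 2 as
SETS). [cite: GreenbergVatsal2000, §2 pp. 16, 23] [cite: GreenbergLNM1716, §2 pp. 83–84] -/
theorem selRel_eq_unrInf (hGood : Rank1Residual.GoodSS W 2) (κ : ZpExtension ℚ 2) (hκ : κ.IsCyclotomic)
    {A : Type} [AddCommGroup A] [DistribMulAction (absoluteGaloisGroup ℚ) A] [TopologicalSpace A]
    [DiscreteTopology A] {n : ℕ}
    (Θ : ∀ v : HeightOneSpectrum (𝓞 ℚ), ((2 : ℕ) : 𝓞 ℚ) ∈ v.asIdeal → (A ≃+ (Fin n → ↥(W.geomPrimaryTorsion 2))))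
    (hΘ : ∀ v hv (δ : absoluteGaloisGroup (v.adicCompletion ℚ)) m i,
      Θ v hv (resGalOfEmb (closureEmb (K := ℚ) (v.adicCompletion ℚ)) δ • m) i =
        resGalOfEmb (closureEmb (K := ℚ) (v.adicCompletion ℚ)) δ • Θ v hv m i)
    (S₀ : Set (HeightOneSpectrum (𝓞 ℚ))) :
    {y : subgroupH1 κ.kerSubgroup A |
        y ∈ GreenbergVatsal2000.unramifiedOutside κ.kerSubgroup A 2 S₀ ∧
        (∀ w σ, conjH1 κ.kerSubgroup A σ y ∈ GreenbergSelmer.infKer κ.kerSubgroup A w) ∧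
        ∀ v hv σ, ∃ (φ : contOneCocycles (discreteTopRep ↥κ.kerSubgroup A))
          (Q : Fin n → localPoints W (v.adicCompletion ℚ)) (k : ℕ),
          oneCocycleClass (discreteTopRep ↥κ.kerSubgroup A) φ = conjH1 κ.kerSubgroup A σ y ∧
          (∀ i, (2 ^ k) • Q i ∈ Sprung2012.localTowerPointsOfEmb κ (closureEmb (K := ℚ) (v.adicCompletion ℚ)) W) ∧
          ∀ τ i, pointsMapOfEmb W (closureEmb (K := ℚ) (v.adicCompletion ℚ))
            (((Θ v hv (φ.1 (resGalSubgroupOfEmb κ.kerSubgroup (closureEmb (K := ℚ) (v.adicCompletion ℚ)) τ))) i :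
              ↥(W.geomPrimaryTorsion 2)) : W.geomPoints) = (τ : absoluteGaloisGroup (v.adicCompletion ℚ)) • Q i - Q i}
      = {y | y ∈ GreenbergVatsal2000.unramifiedOutside κ.kerSubgroup A 2 S₀ ∧
          ∀ w σ, conjH1 κ.kerSubgroup A σ y ∈ GreenbergSelmer.infKer κ.kerSubgroup A w} :=
  setOf_relaxedKummer_eq W hGood κ hκ Θ hΘ _ _

/-- **Item 6's transfer step, local clause at `2` discharged (T1 ∧ T2 ⟹ ∈ SelRel₍C4₎).** A class unramified outside
`2S₀` (k3-g13 T1 `transferH1_mem_unramifiedOutside`) and trivial at `∞` under all conjugates (T2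
`conjH1_transferH1_mem_infKer`) lies in (C4)'s `SelRel` — its third clause (3♭) is supplied by §2, for every `σ` and
every `v ∋ 2`; no level Kummer witness, no `[kum]` hypothesis. [cite: GreenbergVatsal2000, §2 pp. 16, 23]
[cite: CoatesGreenberg1996, Cor. 3.2] -/
theorem mem_selRel_of_unr_inf (hGood : Rank1Residual.GoodSS W 2) (κ : ZpExtension ℚ 2) (hκ : κ.IsCyclotomic)
    {A : Type} [AddCommGroup A] [DistribMulAction (absoluteGaloisGroup ℚ) A] [TopologicalSpace A]
    [DiscreteTopology A] {n : ℕ}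
    (Θ : ∀ v : HeightOneSpectrum (𝓞 ℚ), ((2 : ℕ) : 𝓞 ℚ) ∈ v.asIdeal → (A ≃+ (Fin n → ↥(W.geomPrimaryTorsion 2))))
    (hΘ : ∀ v hv (δ : absoluteGaloisGroup (v.adicCompletion ℚ)) m i,
      Θ v hv (resGalOfEmb (closureEmb (K := ℚ) (v.adicCompletion ℚ)) δ • m) i =
        resGalOfEmb (closureEmb (K := ℚ) (v.adicCompletion ℚ)) δ • Θ v hv m i)
    (S₀ : Set (HeightOneSpectrum (𝓞 ℚ))) (y : subgroupH1 κ.kerSubgroup A)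
    (hunr : y ∈ GreenbergVatsal2000.unramifiedOutside κ.kerSubgroup A 2 S₀)
    (hinf : ∀ w σ, conjH1 κ.kerSubgroup A σ y ∈ GreenbergSelmer.infKer κ.kerSubgroup A w) :
    y ∈ {y : subgroupH1 κ.kerSubgroup A |
        y ∈ GreenbergVatsal2000.unramifiedOutside κ.kerSubgroup A 2 S₀ ∧
        (∀ w σ, conjH1 κ.kerSubgroup A σ y ∈ GreenbergSelmer.infKer κ.kerSubgroup A w) ∧
        ∀ v hv σ, ∃ (φ : contOneCocycles (discreteTopRep ↥κ.kerSubgroup A))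
          (Q : Fin n → localPoints W (v.adicCompletion ℚ)) (k : ℕ),
          oneCocycleClass (discreteTopRep ↥κ.kerSubgroup A) φ = conjH1 κ.kerSubgroup A σ y ∧
          (∀ i, (2 ^ k) • Q i ∈ Sprung2012.localTowerPointsOfEmb κ (closureEmb (K := ℚ) (v.adicCompletion ℚ)) W) ∧
          ∀ τ i, pointsMapOfEmb W (closureEmb (K := ℚ) (v.adicCompletion ℚ))
            (((Θ v hv (φ.1 (resGalSubgroupOfEmb κ.kerSubgroup (closureEmb (K := ℚ) (v.adicCompletion ℚ)) τ))) i :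
              ↥(W.geomPrimaryTorsion 2)) : W.geomPoints) = (τ : absoluteGaloisGroup (v.adicCompletion ℚ)) • Q i - Q i} :=
  ⟨hunr, hinf, fun v hv σ ↦ relaxedKummerClause_conjH1 W hGood κ hκ Θ hΘ y v hv σ⟩

omit [W.IsElliptic] [W.IsGloballyMinimal] in
/-- **Monotonicity of the Kummer clause in the local subgroup `L`** (plus points `⨆_m E⁺_m ≤` tower points, strict
`⊥ ≤` anything): a Kummer datum for `L` is one for any `L' ≥ L`. Hence `Sel₀ ⊆ Sg ⊆ SelRel` clause-wise, and by §2
the LAST inclusion is into ALL of `{unr ∧ inf}`. [folklore] -/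
theorem kummerClause_mono {E : Type} [Field E] [Algebra ℚ E] {n : ℕ} {L L' : AddSubgroup (localPoints W E)}
    (hLL' : L ≤ L') {T : Type} (c : T → Fin n → localPoints W E) (g : T → absoluteGaloisGroup E) :
    (∃ (Q : Fin n → localPoints W E) (k : ℕ), (∀ i, (2 ^ k) • Q i ∈ L) ∧ ∀ t i, c t i = g t • Q i - Q i) →
    (∃ (Q : Fin n → localPoints W E) (k : ℕ), (∀ i, (2 ^ k) • Q i ∈ L') ∧ ∀ t i, c t i = g t • Q i - Q i) :=
  fun ⟨Q, k, hQ, hc⟩ ↦ ⟨Q, k, fun i ↦ hLL' (hQ i), hc⟩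

/-! ## §4  The W-side twin on the habitat, unconditional -/

/-- **No local condition at `2` in `Sel_{2^∞}(E/ℚ_∞)` on the habitat** (`GoodSS W 2`, κ cyclotomic):
`localKerOver 2 (ker κ) ℚ_v = ⊤`, Greenberg's deduction with [CoGr] Cor. 3.2 now a tree theorem.
[cite: GreenbergLNM1716, §2 pp. 83–84] [cite: CoatesGreenberg1996, Cor. 3.2] -/
theorem localKerOver_kerSubgroup_eq_top_at_two (hGood : Rank1Residual.GoodSS W 2) (κ : ZpExtension ℚ 2)
    (hκ : κ.IsCyclotomic) (v : HeightOneSpectrum (𝓞 ℚ)) (hv : ((2 : ℕ) : 𝓞 ℚ) ∈ v.asIdeal) :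
    W.localKerOver 2 κ.kerSubgroup (v.adicCompletion ℚ) = ⊤ :=
  have hgood : W.HasGoodReductionAt v := W.hasGoodReductionAt_of_hasGoodReductionAtPrime v hv hGood.1
  have hss : ¬ W.HasUnitRootAt v := by
    rw [W.hasUnitRootAt_iff_not_dvd_frobeniusTrace v Nat.prime_two hv, not_not]; exact hGood.2
  W.localKerOver_kerSubgroup_eq_top_of_supersingular κ hv hgood hss
    (Summit.BirchSwinnertonDyer.BirchSwinnertonDyer.Theorems.CoatesGreenberg1996_H1_formalGroup_trivial_holds
      ℚ W 2 κ v hκ hv hgood)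

end Summit.BirchSwinnertonDyer.BirchSwinnertonDyer.Theorems.ThetaTransport.CofreeSelmerTransfer

end
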